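import Literature.NumberTheory.Sieve.PolynomialCongruencesPrimeModuliProofs
import Literature.NumberTheory.Sieve.QuadraticRootsPrimeModuliDFIProposition4
import Literature.NumberTheory.Sieve.QuadraticRootsPrimeModuliTothSplit
import HarnessLib

/-!
# Duke–Friedlander–Iwaniec 1995 DISCHARGED; the merged DFI–Tóth fact from Tóth's two inputs

Topic `Literature/NumberTheory/Sieve`; composition file (theorems only, no new definitions, no
new named facts).

* `dukeFriedlanderIwaniec1995_quadraticRoots_primeModuli_holds` — DISCHARGE of the named fact
  `dukeFriedlanderIwaniec1995_quadraticRoots_primeModuli` (`PolynomialCongruencesPrimeModuli.lean`: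
  W. Duke, J. B. Friedlander, H. Iwaniec, Ann. of Math. 141 (1995), Theorem p. 424 — for
  `f = aX² + 2bX + c`, `ac − b² > 0`, `h ≠ 0`: `∑_{p ≤ x} ρ_h(p) = o(π(x))`): the one-liner
  announced in `PolynomialCongruencesPrimeModuliProofs` ("to be appended here once Proposition 4
  is proved"), now that `dukeFriedlanderIwaniec1995_proposition4_holds`
  (`QuadraticRootsPrimeModuliDFIProposition4.lean`) and `dukeFriedlanderIwaniec1995_theorem5_holds`
  are theorems of the tree. The whole printed proof (§§2–7) is thereby formalised.
* `dukeFriedlanderIwaniecToth_quadraticRoots_primeModuli_holds_of` — the SPLIT ASSEMBLY of the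
  merged named fact `dukeFriedlanderIwaniecToth_quadraticRoots_primeModuli`
  (`PolynomialCongruences.lean`, every irreducible quadratic): with the negative-discriminant half
  proved, the fact hinges exactly on the two analytic inputs of Tóth 2000 (positive discriminant)
  named in `QuadraticRootsPrimeModuliTothSplit.lean` — `toth2000_weylLinearForm` (Tóth's Weyl
  linear form estimate, Ngo 2024 (1.3)) and `toth2000_bilinearForm` (the bilinear form bound) —
  through `toth2000_quadraticRoots_primeModuli_holds_of` and
  `dukeFriedlanderIwaniecToth_quadraticRoots_primeModuli_of_proposition4_of_toth`.

## References

* W. Duke, J. B. Friedlander, H. Iwaniec, *Equidistribution of roots of a quadratic congruence to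
  prime moduli*, Ann. of Math. (2) 141 (1995) 423–441, Theorem p. 424, Proposition 4 p. 432,
  §§4–7. [DukeFriedlanderIwaniec1995]
* Á. Tóth, *Roots of quadratic congruences*, IMRN 2000:14, 719–739, main theorem. [Toth2000]
* H. T. Ngo, *On roots of quadratic congruences*, Bull. LMS 56 (2024), (1.2)–(1.3). [Ngo2024]
-/

namespace Literature.NumberTheory.Sieve

/-- **Duke–Friedlander–Iwaniec 1995, Theorem (p. 424), PROVED**: for `f = aX² + 2bX + c ∈ ℤ[X]`
with `ac − b² > 0` and every `h ≠ 0`, `∑_{p ≤ x} ρ_h(p) = o(π(x))` — discharge of the named fact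
`dukeFriedlanderIwaniec1995_quadraticRoots_primeModuli` by
`dukeFriedlanderIwaniec1995_quadraticRoots_primeModuli_of_proposition4` (§§4–7, Theorem 5 proved)
applied to `dukeFriedlanderIwaniec1995_proposition4_holds` (§§2–3, the spectral bound for
smoothed linear forms, proved). [cite: DukeFriedlanderIwaniec1995, Theorem p. 424, Proposition 4 p. 432 and §§4–7] -/
theorem dukeFriedlanderIwaniec1995_quadraticRoots_primeModuli_holds :
    dukeFriedlanderIwaniec1995_quadraticRoots_primeModuli :=
  dukeFriedlanderIwaniec1995_quadraticRoots_primeModuli_of_proposition4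
    dukeFriedlanderIwaniec1995_proposition4_holds

/-- **The merged Duke–Friedlander–Iwaniec–Tóth fact from Tóth's two analytic inputs (split
assembly).** `toth2000_weylLinearForm → toth2000_bilinearForm →
dukeFriedlanderIwaniecToth_quadraticRoots_primeModuli`: the negative-discriminant half is
`dukeFriedlanderIwaniec1995_quadraticRoots_primeModuli_holds`, the positive-discriminant half is
Tóth's theorem from its inputs (`toth2000_quadraticRoots_primeModuli_holds_of`).
[cite: Toth2000, main theorem] [cite: DukeFriedlanderIwaniec1995, Theorem p. 424 and §7] -/
theorem dukeFriedlanderIwaniecToth_quadraticRoots_primeModuli_holds_of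
    (h₁ : toth2000_weylLinearForm) (h₂ : toth2000_bilinearForm) :
    dukeFriedlanderIwaniecToth_quadraticRoots_primeModuli :=
  dukeFriedlanderIwaniecToth_quadraticRoots_primeModuli_of_proposition4_of_toth
    dukeFriedlanderIwaniec1995_proposition4_holds (toth2000_quadraticRoots_primeModuli_holds_of h₁ h₂)

end Literature.NumberTheory.Sieve
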